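import Summits.CriticalPhenomena.PercolationContinuityZ3.Theorems.PercLowPointHalfSpaceTallClusterMassBoundArrowOneThreshold
import Summits.CriticalPhenomena.PercolationContinuityZ3.Theorems.PercLowPointHalfSpaceTallClusterMassBoundBypass

/-!
# `TallClusterMassBound` (stmt-CriticalPhenomena-0912), line `onesided-halves` — forms of the stub
# `stub_noFatHalfBoxOrigin` (B♯, the `p ≤ p_c` half)

The registered stub B♯ of the skeleton `Cruxes/TallClusterMassBound/Lines/onesided_halves.lean` reads: at `p_c(ℤ³)`,
for bond percolation on the INDUCED half-space `ℍ = {x | 0 ≤ x 0}` (`P^ℍ = floorDilutedPercolation 3 p_c 1`), the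
largest cluster trace on the half-box `Λ_n = B_n ∩ ℍ` satisfies `P^ℍ(|K_max(Λ_n)| ≥ C n^{11/4}) ≤ e^{-1}` for all
`n ≥ 1` and SOME `C > 0`. It is verbatim the stub `stub_noFatHalfBoxOrigin` of crux K's line (stmt-CriticalPhenomena-14713)
and it is NOT proved here (open, crux-sized: an averaged critical-connectivity UPPER bound at the `η ≥ -1/2` threshold).
This file records, sorry-free:

* `stub_noFatHalfBoxOrigin_of_squareSubharmonic` — **stmt-CriticalPhenomena-11506 ⟹ B♯ with the exact registered
  signature** (the landed feeder `Restatement.noFatHalfBoxOrigin_of_squareSubharmonic`, p136366, elaborates against the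
  stub's statement by `exact`): the stub closes the day `SquareSubharmonic` lands.
* `noFatHalfBoxOrigin_iff_typicalMax_le` — **B♯ ⟺ `typicalMax P^ℍ Λ_n ≤ C n^{11/4}` for all `n ≥ 1`** (Hutchcroft's
  `1/e`-quantile `typicalMax = min{m | P(|K_max(Λ_n)| ≥ m) ≤ e^{-1}}`): `→` is `typicalMax_le_of_noFatHalfBoxOrigin` (= the glue
  lemma `typicalMax_le_of_noFat`, p140915); `←` takes
  `C' = max C 1 + 1`, so that `typicalMax ≤ C n^{11/4} < C' n^{11/4}` puts the event `{C' n^{11/4} ≤ |K_max(Λ_n)|}` inside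
  `{typicalMax ≤ |K_max(Λ_n)|}`, of probability `≤ e^{-1}` (`real_typicalMax_le_clusterMaxIn_le`).
* `typicalMax_le_of_squareSubharmonic` — the composition: stmt-11506 ⟹ `typicalMax P^ℍ Λ_n ≤ C n^{11/4}`.

No definitions, no new facts; `SquareSubharmonic` (stmt-CriticalPhenomena-11506, UNPROVED) enters only as an explicit
hypothesis. [folklore]
-/

noncomputable section

open MeasureTheory Finset Filter
open Literature.Probability.Percolation Literature.Probability.LatticeModels
open Summit.CriticalPhenomena.PercolationContinuityZ3.Theses.PercSubharmonicSquare (SquareSubharmonic)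
open Summit.CriticalPhenomena.PercolationContinuityZ3.Theorems.TallClusterMassBound.Negative
open Summit.CriticalPhenomena.PercolationContinuityZ3.Theorems.TallClusterMassBound.TightnessLine

namespace Summit.CriticalPhenomena.PercolationContinuityZ3.Theorems.TallClusterMassBound.OnesidedHalves

/-- **stmt-CriticalPhenomena-11506 ⟹ B♯, exact registered signature.** If `τ_p²` is nearest-neighbour sub-mean-value
off a box for all `p < p_c(ℤ³)` (`SquareSubharmonic`), then for some `C > 0` and all `n ≥ 1`,
`P^ℍ_{p_c}(|K_max(B_n ∩ ℍ)| ≥ C n^{11/4}) ≤ e^{-1}` — the landed feeder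
`Restatement.noFatHalfBoxOrigin_of_squareSubharmonic` (p136366: pointwise `τ_{p_c} ≤ C‖x‖^{-1/2}`, half-box
susceptibility `≤ C n^{5/2}`, second-moment count `FloorRusso.NoFatForms.stub_noFatOfSusceptibility`). [folklore] -/
theorem stub_noFatHalfBoxOrigin_of_squareSubharmonic
    (h : Summit.CriticalPhenomena.PercolationContinuityZ3.Theses.PercSubharmonicSquare.SquareSubharmonic) :
    ∃ C : ℝ, 0 < C ∧ ∀ n : ℕ, 1 ≤ n → (Literature.Probability.Percolation.floorDilutedPercolation 3 (Literature.Probability.Percolation.criticalProbI 3) 1).real {ω | C * (n : ℝ) ^ ((11 : ℝ) / 4) ≤ (Literature.Probability.Percolation.clusterMaxIn ((Literature.Probability.LatticeModels.box 3 n).filter fun z : Literature.Probability.LatticeModels.Site 3 => 0 ≤ z 0) ω : ℝ)} ≤ Real.exp (-1) :=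
  Restatement.noFatHalfBoxOrigin_of_squareSubharmonic h

/-- **B♯ ⟹ `typicalMax ≤ (C+1) n^{11/4}`** (the `→` half of `noFatHalfBoxOrigin_iff_typicalMax_le`; same statement and
proof as the line's glue lemma `typicalMax_le_of_noFat`, p140915, kept here so that this file does not depend on the glue
module): `⌈C n^{11/4}⌉` lies in the defining set of Hutchcroft's `1/e`-quantile
`typicalMax = min{m | P(|K_max(Λ_n)| ≥ m) ≤ e^{-1}}`. [folklore] -/
theorem typicalMax_le_of_noFatHalfBoxOrigin
    (h : ∃ C : ℝ, 0 < C ∧ ∀ n : ℕ, 1 ≤ n → (floorDilutedPercolation 3 (criticalProbI 3) 1).real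
      {ω | C * (n : ℝ) ^ ((11 : ℝ) / 4) ≤ (clusterMaxIn ((box 3 n).filter fun z : Site 3 => 0 ≤ z 0) ω : ℝ)} ≤
        Real.exp (-1)) :
    ∃ C : ℝ, ∀ n : ℕ, 1 ≤ n →
      (typicalMax (floorDilutedPercolation 3 (criticalProbI 3) 1) (halfBox n) : ℝ) ≤ C * (n : ℝ) ^ ((11 : ℝ) / 4) := by
  -- adapted from `OnesidedHalves.typicalMax_le_of_noFat` (Theorems/PercLowPointHalfSpaceTallClusterMassBoundOnesidedHalvesGlue.lean)
  obtain ⟨C, hC, hfat⟩ := h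
  refine ⟨C + 1, fun r hr => ?_⟩
  set μ := floorDilutedPercolation 3 (criticalProbI 3) 1
  have hr1 : (1 : ℝ) ≤ r := by exact_mod_cast hr
  have hR : 1 ≤ (r : ℝ) ^ ((11 : ℝ) / 4) := Real.one_le_rpow hr1 (by norm_num)
  have hct0 : 0 ≤ C * (r : ℝ) ^ ((11 : ℝ) / 4) := by positivity
  set t : ℕ := ⌈C * (r : ℝ) ^ ((11 : ℝ) / 4)⌉₊ with ht
  have hmem : μ.real {ω | t ≤ clusterMaxIn (halfBox r) ω} ≤ Real.exp (-1) := by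
    refine le_trans ?_ (hfat r hr)
    refine measureReal_mono ?_ (measure_ne_top _ _)
    intro ω hω
    have hω' : (t : ℝ) ≤ (clusterMaxIn (halfBox r) ω : ℝ) := by exact_mod_cast hω
    exact (Nat.le_ceil _).trans hω'
  have hle : typicalMax μ (halfBox r) ≤ t := Nat.sInf_le hmem
  have hle' : (typicalMax μ (halfBox r) : ℝ) ≤ (t : ℝ) := by exact_mod_cast hle
  calc (typicalMax μ (halfBox r) : ℝ) ≤ t := hle'
    _ ≤ C * (r : ℝ) ^ ((11 : ℝ) / 4) + 1 := (Nat.ceil_lt_add_one hct0).le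
    _ ≤ C * (r : ℝ) ^ ((11 : ℝ) / 4) + (r : ℝ) ^ ((11 : ℝ) / 4) := by linarith
    _ = (C + 1) * (r : ℝ) ^ ((11 : ℝ) / 4) := by ring

/-- **B♯ ⟺ a polynomial bound on Hutchcroft's typical max**: the registered stub `stub_noFatHalfBoxOrigin`
(`∃ C > 0, ∀ n ≥ 1, P^ℍ_{p_c}(|K_max(B_n ∩ ℍ)| ≥ C n^{11/4}) ≤ e^{-1}`) holds iff
`∃ C, ∀ n ≥ 1, typicalMax P^ℍ_{p_c} Λ_n ≤ C n^{11/4}` (`Λ_n = halfBox n = B_n ∩ ℍ`). `→`: `⌈C n^{11/4}⌉` lies in the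
defining set of the `1/e`-quantile (`typicalMax_le_of_noFatHalfBoxOrigin`). `←`: with `C' = max C 1 + 1 > 0`,
`typicalMax ≤ C n^{11/4} < C' n^{11/4}`, so `{C' n^{11/4} ≤ |K_max(Λ_n)|} ⊆ {typicalMax ≤ |K_max(Λ_n)|}`, whose probability
is `≤ e^{-1}` (`real_typicalMax_le_clusterMaxIn_le`). [folklore] -/
theorem noFatHalfBoxOrigin_iff_typicalMax_le :
    (∃ C : ℝ, 0 < C ∧ ∀ n : ℕ, 1 ≤ n → (Literature.Probability.Percolation.floorDilutedPercolation 3 (Literature.Probability.Percolation.criticalProbI 3) 1).real {ω | C * (n : ℝ) ^ ((11 : ℝ) / 4) ≤ (Literature.Probability.Percolation.clusterMaxIn ((Literature.Probability.LatticeModels.box 3 n).filter fun z : Literature.Probability.LatticeModels.Site 3 => 0 ≤ z 0) ω : ℝ)} ≤ Real.exp (-1)) ↔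
    (∃ C : ℝ, ∀ n : ℕ, 1 ≤ n → (typicalMax (floorDilutedPercolation 3 (criticalProbI 3) 1) (halfBox n) : ℝ) ≤ C * (n : ℝ) ^ ((11 : ℝ) / 4)) := by
  constructor
  · exact typicalMax_le_of_noFatHalfBoxOrigin
  · rintro ⟨C, hC⟩
    have hC'0 : 0 < max C 1 + 1 := by
      have := le_max_right C 1
      linarith
    refine ⟨max C 1 + 1, hC'0, fun n hn => ?_⟩
    set μ := floorDilutedPercolation 3 (criticalProbI 3) 1 with hμ
    have hR : 0 < (n : ℝ) ^ ((11 : ℝ) / 4) := by positivity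
    have hlt : (typicalMax μ (halfBox n) : ℝ) < (max C 1 + 1) * (n : ℝ) ^ ((11 : ℝ) / 4) :=
      calc (typicalMax μ (halfBox n) : ℝ) ≤ C * (n : ℝ) ^ ((11 : ℝ) / 4) := hC n hn
        _ ≤ max C 1 * (n : ℝ) ^ ((11 : ℝ) / 4) := mul_le_mul_of_nonneg_right (le_max_left _ _) hR.le
        _ < (max C 1 + 1) * (n : ℝ) ^ ((11 : ℝ) / 4) := by nlinarith
    refine le_trans (measureReal_mono ?_ (measure_ne_top _ _)) (real_typicalMax_le_clusterMaxIn_le μ (halfBox n))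
    intro ω hω
    have hω' : (max C 1 + 1) * (n : ℝ) ^ ((11 : ℝ) / 4) ≤ (clusterMaxIn (halfBox n) ω : ℝ) := hω
    have hle : (typicalMax μ (halfBox n) : ℝ) ≤ (clusterMaxIn (halfBox n) ω : ℝ) := hlt.le.trans hω'
    exact_mod_cast hle

/-- **stmt-CriticalPhenomena-11506 ⟹ `typicalMax P^ℍ_{p_c} Λ_n ≤ C n^{11/4}`** for all `n ≥ 1`: the composition of
`stub_noFatHalfBoxOrigin_of_squareSubharmonic` with `noFatHalfBoxOrigin_iff_typicalMax_le`. [folklore] -/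
theorem typicalMax_le_of_squareSubharmonic
    (h : Summit.CriticalPhenomena.PercolationContinuityZ3.Theses.PercSubharmonicSquare.SquareSubharmonic) :
    ∃ C : ℝ, ∀ n : ℕ, 1 ≤ n →
      (typicalMax (floorDilutedPercolation 3 (criticalProbI 3) 1) (halfBox n) : ℝ) ≤ C * (n : ℝ) ^ ((11 : ℝ) / 4) :=
  noFatHalfBoxOrigin_iff_typicalMax_le.1 (stub_noFatHalfBoxOrigin_of_squareSubharmonic h)

end Summit.CriticalPhenomena.PercolationContinuityZ3.Theorems.TallClusterMassBound.OnesidedHalves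

end
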